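import Summits.ValiantsHypothesis.ValiantsHypothesis.Theorems.BarrierLeverChowBenchmarkPairsSplitCertDefs

/-!
# Route BarrierLever — item 22038 `ChowBenchmarkPairs`, line `moore-peel`: SPLIT CERTIFICATES — part 2: the algebra of ONE ENTRY
# of a split (scaling identity `X^{α i} M^X_{ij} = N_{ij} X^{β j}` and the value `N_{ij}(0)` = the leading datum of the checker)

Helper file (`--supports stmt-ValiantsHypothesis-22038`; cell valiant-natproofs, rung V4; seat val-np-p4 gen 24).  Closes NO item.

For an entry `s · dirE P S w T` of an instance (`…SplitCertDefs`) at the HEIGHT TABLE of coordinate `c` with rank function `ρ`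
(`…ChowBenchmarkPairsSplit.heightTable`: `P_{a,c} ↦ X^{ρ a}`, other coordinates constant), and potentials `a` (row), `b` (column)
admitted by `newEnt`, the polynomial `nEnt` satisfies `X^a · (s · dirE (heightTable P c ρ) S w T) = nEnt · X^b` (`entry_scale`, from the
one-coordinate expansion `dirE_heightTable_insert`) and `nEnt(0) = s' · dirE P S w' T'` where `(s', w')` is the leading datum returned by
`newEnt` and `T' = T ∖ {c}` (`entry_eval_zero`).  Also: the small dictionary between list data and finsets (`Sof`, `Tof`, `wOf` lemmas).

WHAT THIS IS NOT: bookkeeping; no stub of the line is closed; nothing on crux stmt-ValiantsHypothesis-14610 or on `VP` versus `VNP`.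
-/

set_option linter.dupNamespace false
set_option autoImplicit false

namespace Summit.ValiantsHypothesis.ValiantsHypothesis.Theorems.BarrierLever.ChowBenchmarkSplit

open Finset Polynomial

namespace Cert

variable {p k : ℕ}

/-! ## 3. Semantic lemmas: entries, weights, supports, columns -/

section Semantics

variable {κ : Type*} [DecidableEq κ] {R : Type*} [CommRing R] {π : Type*} [DecidableEq π]

/-- Entries only read the weights at the points of the row. -/
theorem dirE_congr_weights (P : π → κ → R) (S : Finset π) {w w' : π → ℕ} (T : Finset κ)
    (h : ∀ a ∈ S, w a = w' a) : dirE P S w T = dirE P S w' T := by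
  unfold dirE
  refine Finset.sum_congr rfl fun g _ => ?_
  congr 1
  exact Finset.prod_congr rfl fun a _ => by rw [h _ a.2]

/-- At the empty column every entry is `1`. -/
theorem dirE_empty_col (P : π → κ → R) (S : Finset π) (w : π → ℕ) : dirE P S w ∅ = 1 := by
  unfold dirE
  have hu : (Finset.univ : Finset (↥(∅ : Finset κ) → ↥S)) = {fun c => (IsEmpty.false c).elim} := by
    apply Finset.eq_singleton_iff_unique_mem.mpr
    refine ⟨Finset.mem_univ _, fun g _ => funext fun c => (IsEmpty.false c).elim⟩
  rw [hu, Finset.sum_singleton, Finset.univ_eq_empty, Finset.prod_empty, one_mul]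
  refine Finset.prod_eq_one fun a _ => ?_
  simp

/-- At a nonempty column the empty row vanishes. -/
theorem dirE_empty_row (P : π → κ → R) (w : π → ℕ) {T : Finset κ} (hT : T.Nonempty) : dirE P ∅ w T = 0 := by
  unfold dirE
  have : IsEmpty (↥T → ↥(∅ : Finset π)) := by
    obtain ⟨c, hc⟩ := hT
    exact ⟨fun g => Finset.notMem_empty _ (g ⟨c, hc⟩).2⟩
  rw [Finset.univ_eq_empty, Finset.sum_empty]

/-- `c`-free columns do not see the heights of the height table. -/
theorem dirE_heightTable_of_not_mem (P : π → κ → R) (c : κ) (r : π → ℕ) (S : Finset π) (w : π → ℕ)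
    {T : Finset κ} (hc : c ∉ T) : dirE (heightTable P c r) S w T = C (dirE P S w T) := by
  rw [heightTable, dirE_setCol_of_not_mem _ _ _ _ _ hc, ← map_dirE C]

end Semantics

/-- Membership in the column of a code. -/
theorem mem_Tof {m : ℕ} {c : Fin k} : c ∈ Tof k m ↔ Nat.testBit m c = true := by
  simp [Tof]

/-- The code `0` is the empty column. -/
theorem Tof_zero : Tof k 0 = ∅ := by
  ext c; simp [Tof]

/-- Clearing a set bit: the old column is the new one plus `c`, and `c` is not in the new one. -/
theorem Tof_eq_insert_newCol {m c : ℕ} (hc : c < k) (hm : Nat.testBit m c = true) :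
    Tof k m = insert ⟨c, hc⟩ (Tof k (newCol c m)) ∧ (⟨c, hc⟩ : Fin k) ∉ Tof k (newCol c m) := by
  have key : ∀ i : ℕ, Nat.testBit (newCol c m) i = (decide (i ≠ c) && Nat.testBit m i) := by
    intro i
    rw [newCol, if_pos hm, Nat.testBit_xor, Nat.testBit_two_pow]
    by_cases h : i = c
    · subst h; simp [hm]
    · have : ¬ c = i := fun e => h e.symm
      simp [h, this]
  constructor
  · ext x
    rw [Finset.mem_insert, mem_Tof, mem_Tof, key]
    by_cases hx : x = ⟨c, hc⟩
    · subst hx; simp [hm]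
    · have hx' : (x : ℕ) ≠ c := fun e => hx (Fin.ext e)
      simp [hx, hx']
  · rw [mem_Tof, key]; simp

/-- On a `c`-free column the code is unchanged. -/
theorem newCol_of_not {m c : ℕ} (hm : ¬ Nat.testBit m c = true) : newCol c m = m := by
  rw [newCol, if_neg hm]

/-- A `c`-free code gives a `c`-free column. -/
theorem not_mem_Tof {m c : ℕ} (hc : c < k) (hm : ¬ Nat.testBit m c = true) : (⟨c, hc⟩ : Fin k) ∉ Tof k m := by
  rw [mem_Tof]; exact hm

/-- The support of the empty list. -/
theorem Sof_nil : Sof p [] = ∅ := by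
  ext a; simp [Sof]

/-- The support of a one-point list. -/
theorem Sof_single {x : ℕ} (hx : x < p) : Sof p [x] = {⟨x, hx⟩} := by
  ext a; simp [Sof, Fin.ext_iff]

/-- The support of a two-point list. -/
theorem Sof_pair {x y : ℕ} (hx : x < p) (hy : y < p) : Sof p [x, y] = {⟨x, hx⟩, ⟨y, hy⟩} := by
  ext a; simp [Sof, Fin.ext_iff]

/-- Every point of a support comes from the list. -/
theorem val_mem_of_mem_Sof {ps : List ℕ} {a : Fin p} (ha : a ∈ Sof p ps) : (a : ℕ) ∈ ps := by
  simpa [Sof] using ha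

/-- Raising the first weight = updating the weight function at the first point (one-point rows). -/
theorem wOf_raise1_single {x : ℕ} (hx : x < p) (e : ℕ × ℕ × ℕ) :
    (fun a : Fin p => wOf [x] (raise1 e) a) =
      Function.update (fun a : Fin p => wOf [x] e a) ⟨x, hx⟩ (wOf [x] e (⟨x, hx⟩ : Fin p) + 1) := by
  funext a
  by_cases h : a = ⟨x, hx⟩
  · subst h; simp [wOf, raise1]
  · have h' : (a : ℕ) ≠ x := fun e' => h (Fin.ext e')
    rw [Function.update_of_ne h]; simp [wOf, h']

/-- Raising the first weight (two-point rows). -/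
theorem wOf_raise1_pair {x y : ℕ} (hx : x < p) (e : ℕ × ℕ × ℕ) :
    (fun a : Fin p => wOf [x, y] (raise1 e) a) =
      Function.update (fun a : Fin p => wOf [x, y] e a) ⟨x, hx⟩ (wOf [x, y] e (⟨x, hx⟩ : Fin p) + 1) := by
  funext a
  by_cases h : a = ⟨x, hx⟩
  · subst h; simp [wOf, raise1]
  · have h' : (a : ℕ) ≠ x := fun e' => h (Fin.ext e')
    rw [Function.update_of_ne h]; simp [wOf, raise1, h']

/-- Raising the second weight (two-point rows with distinct points). -/
theorem wOf_raise2_pair {x y : ℕ} (hy : y < p) (hxy : x ≠ y) (e : ℕ × ℕ × ℕ) :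
    (fun a : Fin p => wOf [x, y] (raise2 e) a) =
      Function.update (fun a : Fin p => wOf [x, y] e a) ⟨y, hy⟩ (wOf [x, y] e (⟨y, hy⟩ : Fin p) + 1) := by
  funext a
  by_cases h : a = ⟨y, hy⟩
  · subst h
    have : (y : ℕ) ≠ x := fun e' => hxy e'.symm
    simp [wOf, raise2, this]
  · have h' : (a : ℕ) ≠ y := fun e' => h (Fin.ext e')
    rw [Function.update_of_ne h]
    by_cases hax : (a : ℕ) = x
    · simp [wOf, raise2, hax]
    · simp [wOf, h', hax]

/-- Killing keeps the weights. -/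
theorem wOf_kill (ps : List ℕ) (e : ℕ × ℕ × ℕ) (a : ℕ) : wOf ps (kill e) a = wOf ps e a := by
  unfold wOf kill
  rcases ps with _ | ⟨x, _ | ⟨y, _⟩⟩ <;> simp


/-! ## 4. One entry of a split: the scaling identity and the value at `X = 0` -/

section Entry

variable {R : Type*} [CommRing R]

/-- The one-coordinate expansion with a `Finset` sum. -/
theorem dirE_heightTable_insert' {π κ : Type*} [DecidableEq π] [DecidableEq κ] (P : π → κ → R) (c : κ)
    (r : π → ℕ) (S : Finset π) (w : π → ℕ) {T' : Finset κ} (hc : c ∉ T') :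
    dirE (heightTable P c r) S w (insert c T') =
      ∑ a ∈ S, (w a : R[X]) * X ^ r a * C (dirE P S (Function.update w a (w a + 1)) T') := by
  rw [dirE_heightTable_insert P c r S w hc,
    ← Finset.sum_coe_sort S (fun a => (w a : R[X]) * X ^ r a * C (dirE P S (Function.update w a (w a + 1)) T'))]

/-- The polynomial entry `N_{ij}` of a split: `X^{α i} · M^X_{ij} = N_{ij} · X^{β j}` (`entry_scale`), and its value
at `X = 0` is the leading datum (`entry_eval_zero`). -/
noncomputable def nEnt (P : Fin p → Fin k → R) (c : Fin k) (r : Fin p → ℕ) (a b : ℕ) (ps : List ℕ)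
    (e : ℕ × ℕ × ℕ) (m : ℕ) : R[X] :=
  if e.1 = 0 then 0
  else if Nat.testBit m c = true then
    ((e.1 : ℕ) : R[X]) * ∑ x ∈ Sof p ps, ((wOf ps e x : ℕ) : R[X]) * X ^ (r x + a - b) *
      C (dirE P (Sof p ps) (Function.update (fun y : Fin p => wOf ps e y) x (wOf ps e x + 1)) (Tof k (newCol c m)))
  else X ^ (a - b) * C (((e.1 : ℕ) : R) * dirE P (Sof p ps) (fun y : Fin p => wOf ps e y) (Tof k m))

/-- What the Boolean of `newEnt` says on a `c`-column: every support point satisfies `b ≤ ρ x + a`, and two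
distinct... (at most one of the first two) support points are not both tight. -/
theorem newEnt_cCol {c : ℕ} {ρ : List ℕ} {a b : ℕ} {ps : List ℕ} (hlen : ps.length ≤ 2) {e : ℕ × ℕ × ℕ} {m : ℕ}
    (h0 : ¬ e.1 = 0) (hm : Nat.testBit m c = true) (hok : (newEnt c ρ a b ps e m).1 = true) :
    ∀ x ∈ ps, b ≤ ρ.getD x 0 + a := by
  unfold newEnt at hok
  rw [if_neg h0, if_pos hm] at hok
  rcases ps with _ | ⟨x, _ | ⟨y, _ | ⟨z, t⟩⟩⟩
  · intro x hx; simp at hx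
  · intro z hz
    simp only [List.mem_singleton] at hz
    subst hz
    simpa using hok
  · intro z hz
    simp only [Bool.and_eq_true, decide_eq_true_eq] at hok
    simp only [List.mem_cons, List.not_mem_nil, or_false] at hz
    rcases hz with rfl | rfl
    · exact hok.1.1
    · exact hok.1.2
  · simp at hlen

/-- What the Boolean of `newEnt` says on a `c`-free column: `b ≤ a`. -/
theorem newEnt_free {c : ℕ} {ρ : List ℕ} {a b : ℕ} {ps : List ℕ} {e : ℕ × ℕ × ℕ} {m : ℕ}
    (h0 : ¬ e.1 = 0) (hm : ¬ Nat.testBit m c = true) (hok : (newEnt c ρ a b ps e m).1 = true) : b ≤ a := by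
  unfold newEnt at hok
  rw [if_neg h0, if_neg hm] at hok
  simpa using hok

/-- **THE SCALING IDENTITY of one entry.** -/
theorem entry_scale (P : Fin p → Fin k → R) {c : ℕ} (hc : c < k) (ρ : List ℕ) (a b : ℕ) {ps : List ℕ}
    (hlen : ps.length ≤ 2) (e : ℕ × ℕ × ℕ) (m : ℕ) (hok : (newEnt c ρ a b ps e m).1 = true) :
    (X : R[X]) ^ a * (((e.1 : ℕ) : R[X]) *
        dirE (heightTable P ⟨c, hc⟩ (rOf p ρ)) (Sof p ps) (fun y : Fin p => wOf ps e y) (Tof k m)) =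
      nEnt P ⟨c, hc⟩ (rOf p ρ) a b ps e m * (X : R[X]) ^ b := by
  by_cases h0 : e.1 = 0
  · simp [nEnt, h0]
  by_cases hm : Nat.testBit m c = true
  · have hall := newEnt_cCol hlen h0 hm hok
    obtain ⟨hT, hcT⟩ := Tof_eq_insert_newCol (k := k) hc hm
    rw [nEnt, if_neg h0, if_pos (by exact hm), hT, dirE_heightTable_insert' P _ _ _ _ hcT, Finset.mul_sum,
      Finset.mul_sum, Finset.mul_sum, Finset.sum_mul]
    refine Finset.sum_congr rfl fun x hx => ?_
    have hx' : b ≤ rOf p ρ x + a := hall _ (val_mem_of_mem_Sof hx)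
    calc (X : R[X]) ^ a * (((e.1 : ℕ) : R[X]) * (((wOf ps e x : ℕ) : R[X]) * X ^ (rOf p ρ x) *
            C (dirE P (Sof p ps) (Function.update (fun y : Fin p => wOf ps e y) x (wOf ps e x + 1))
              (Tof k (newCol c m)))))
        = ((e.1 : ℕ) : R[X]) * ((wOf ps e x : ℕ) : R[X]) *
            C (dirE P (Sof p ps) (Function.update (fun y : Fin p => wOf ps e y) x (wOf ps e x + 1))
              (Tof k (newCol c m))) * X ^ (rOf p ρ x + a) := by rw [pow_add]; ring
      _ = ((e.1 : ℕ) : R[X]) * ((wOf ps e x : ℕ) : R[X]) *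
            C (dirE P (Sof p ps) (Function.update (fun y : Fin p => wOf ps e y) x (wOf ps e x + 1))
              (Tof k (newCol c m))) * (X ^ (rOf p ρ x + a - b) * X ^ b) := by
          rw [← pow_add, Nat.sub_add_cancel hx']
      _ = _ := by ring
  · have hab := newEnt_free h0 hm hok
    rw [nEnt, if_neg h0, if_neg hm, dirE_heightTable_of_not_mem _ _ _ _ _ (not_mem_Tof hc hm), map_mul, map_natCast]
    calc (X : R[X]) ^ a * (((e.1 : ℕ) : R[X]) * C (dirE P (Sof p ps) (fun y : Fin p => wOf ps e y) (Tof k m)))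
        = (((e.1 : ℕ) : R[X]) * C (dirE P (Sof p ps) (fun y : Fin p => wOf ps e y) (Tof k m))) * X ^ a := by ring
      _ = (((e.1 : ℕ) : R[X]) * C (dirE P (Sof p ps) (fun y : Fin p => wOf ps e y) (Tof k m))) *
            (X ^ (a - b) * X ^ b) := by rw [← pow_add, Nat.sub_add_cancel hab]
      _ = _ := by ring


/-- Evaluating one summand of `nEnt` at `0`. -/
theorem eval_zero_summand (w t : ℕ) (d : R) :
    ((((w : ℕ) : R[X]) * X ^ t * C d).eval 0) = if t = 0 then (w : R) * d else 0 := by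
  rw [eval_mul, eval_mul, eval_natCast, eval_pow, eval_X, eval_C]
  by_cases ht : t = 0
  · subst ht; simp
  · rw [if_neg ht, zero_pow ht, mul_zero, zero_mul]

/-- **THE VALUE AT `X = 0` of one entry** is the leading datum computed by `newEnt`. -/
theorem entry_eval_zero (P : Fin p → Fin k → R) {c : ℕ} (hc : c < k) (ρ : List ℕ) (a b : ℕ) {ps : List ℕ}
    (hlen : ps.length ≤ 2) (hps : ∀ x ∈ ps, x < p) (hnd : ps.Nodup) (e : ℕ × ℕ × ℕ) (m : ℕ)
    (hok : (newEnt c ρ a b ps e m).1 = true) :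
    (nEnt P ⟨c, hc⟩ (rOf p ρ) a b ps e m).eval 0 =
      (((newEnt c ρ a b ps e m).2.1 : ℕ) : R) *
        dirE P (Sof p ps) (fun y : Fin p => wOf ps (newEnt c ρ a b ps e m).2 y) (Tof k (newCol c m)) := by
  by_cases h0 : e.1 = 0
  · have h2 : (newEnt c ρ a b ps e m).2 = kill e := by
      unfold newEnt; rw [if_pos h0]
    rw [h2, nEnt, if_pos h0, eval_zero]
    simp [kill]
  by_cases hm : Nat.testBit m c = true
  · have hall := newEnt_cCol hlen h0 hm hok
    rw [nEnt, if_neg h0, if_pos (by exact hm), eval_mul, eval_natCast, eval_finsetSum]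
    simp_rw [eval_zero_summand]
    unfold newEnt at hok ⊢
    rw [if_neg h0, if_pos hm] at hok ⊢
    rcases ps with _ | ⟨x, _ | ⟨y, _ | ⟨z, t⟩⟩⟩
    · -- empty support
      simp [Sof_nil, kill]
    · -- one point
      have hx : x < p := hps x (by simp)
      rw [Sof_single hx, Finset.sum_singleton]
      simp only
      by_cases ht : ρ.getD x 0 + a = b
      · have h1 : rOf p ρ ⟨x, hx⟩ + a - b = 0 := by show ρ.getD x 0 + a - b = 0; omega
        rw [if_pos h1, if_pos ht, wOf_raise1_single hx, ← Sof_single hx]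
        simp [raise1, wOf, mul_assoc]
      · have h1 : rOf p ρ ⟨x, hx⟩ + a - b ≠ 0 := by
          have := hall x (by simp); show ρ.getD x 0 + a - b ≠ 0; omega
        rw [if_neg h1, if_neg ht]
        simp [kill]
    · -- two points
      have hx : x < p := hps x (by simp)
      have hy : y < p := hps y (by simp)
      have hxy : x ≠ y := by
        intro e'; subst e'; simp at hnd
      have hne : (⟨x, hx⟩ : Fin p) ≠ ⟨y, hy⟩ := fun e' => hxy (Fin.mk.inj_iff.mp e')
      rw [Sof_pair hx hy, Finset.sum_pair hne]
      simp only
      simp only [Bool.and_eq_true, decide_eq_true_eq, Bool.not_eq_true', Bool.and_eq_false_iff,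
        decide_eq_false_iff_not] at hok
      have hbx := hall x (by simp)
      have hby := hall y (by simp)
      by_cases htx : ρ.getD x 0 + a = b
      · have hty : ¬ ρ.getD y 0 + a = b := fun h' => by rcases hok.2 with h'' | h'' <;> contradiction
        have h1 : rOf p ρ ⟨x, hx⟩ + a - b = 0 := by show ρ.getD x 0 + a - b = 0; omega
        have h2 : rOf p ρ ⟨y, hy⟩ + a - b ≠ 0 := by show ρ.getD y 0 + a - b ≠ 0; omega
        rw [if_pos h1, if_neg h2, add_zero, if_pos htx, wOf_raise1_pair (y := y) hx, ← Sof_pair hx hy]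
        simp [raise1, wOf, mul_assoc]
      · have h1 : rOf p ρ ⟨x, hx⟩ + a - b ≠ 0 := by show ρ.getD x 0 + a - b ≠ 0; omega
        rw [if_neg h1, zero_add, if_neg htx]
        by_cases hty : ρ.getD y 0 + a = b
        · have h2 : rOf p ρ ⟨y, hy⟩ + a - b = 0 := by show ρ.getD y 0 + a - b = 0; omega
          rw [if_pos h2, if_pos hty, wOf_raise2_pair hy hxy, ← Sof_pair hx hy]
          have hyx : ¬ (y = x) := fun e' => hxy e'.symm
          simp [raise2, wOf, hyx, mul_assoc]
        · have h2 : rOf p ρ ⟨y, hy⟩ + a - b ≠ 0 := by show ρ.getD y 0 + a - b ≠ 0; omega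
          rw [if_neg h2, if_neg hty]
          simp [kill]
    · simp at hlen
  · have hab := newEnt_free h0 hm hok
    rw [nEnt, if_neg h0, if_neg hm, eval_mul, eval_pow, eval_X, eval_C, newCol_of_not hm]
    unfold newEnt
    rw [if_neg h0, if_neg hm]
    by_cases he : a = b
    · subst he; simp
    · have h1 : a - b ≠ 0 := by omega
      rw [zero_pow h1, zero_mul, if_neg he]
      simp [kill]

end Entry


end Cert

end Summit.ValiantsHypothesis.ValiantsHypothesis.Theorems.BarrierLever.ChowBenchmarkSplit
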